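import Literature.NumberTheory.Automorphic.NiceTwistedStandardL
import Literature.NumberTheory.GaloisRepresentations.SatakeFamilyOfFramedGaloisRep
import HarnessLib

/-!
# The Cogdell–Piatetski-Shapiro `L`-datum of the `GL₁`-twists of an `ℓ`-adic Galois
# representation (hypothesis-structure over the carrier `TwistedStandardLData`)

Topic `NumberTheory/GaloisRepresentations` (definition request `defn-CompletedGaloisTwistLData`,
wanted by the crux `BrauerQuotientNice` of `route-Langlands-BrauerHeilbronnDescent`,
`stmt-Langlands-19252`: state its layer-2 children — Artin formalism, holomorphy — over ONE datum of
`ρ` shared by all of them instead of an existential one).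

## The printed notion

For a number field `K`, a prime `ℓ`, a field isomorphism `ι : ℚ̄_ℓ ≃ ℂ` and a continuous
`ρ : Γ_K → GL_n(ℚ̄_ℓ)` unramified outside a finite set, the literature attaches to `ρ` (and to each
twist `ρ ⊗ χ` by a Hecke character `χ`, read on the Galois side through class field theory) the
formal Euler product over ALL places

* Taylor, *Galois representations* (2004), §2 [held, `lit read arxiv:math/0212403`, p. 6 of the
  text]: "If `R : G_ℚ → GL(V)` is an `l`-adic representation which is de Rham at `l` **and pure of
  some weight `w ∈ ℤ`**, and if `ι : ℚ̄_l ↪ ℂ` we will define an `L`-function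
  `L(ιR, s) = ∏_p L(ι WD_p(R), p^{-s})`, which will converge to a holomorphic function in
  `Re s > 1 + w/2` … `Λ(ιR, s) = Γ(R, s) L(ιR, s)` [the `Γ`-factor defined from the Hodge–Tate
  multiplicities `m_i^R`, `m^R_{w/2,±}` **under the parity assumption** `m^R_{w/2} ≡ dim V mod 2`],
  `N(R) = ∏_p p^{f(WD_p(R))}`, `ε(ιR) = ε_∞(R, …) ∏_p ι ε(WD_p(R), Ψ_p)`", with Conj. 4 (entire,
  bounded in vertical strips, functional equation) and, §1 Conj. 3, the conjecture that a de Rham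
  a.e.-unramified `R` is part of a compatible system, pure of the predicted weight;
* Buzzard–Gee 2014, §2.2, Conj. 3.2.1 and Rem. 3.2.5 (the unramified dictionary: the Satake
  parameter of the unramified `π_v` is the multiset of `ι`-images of the eigenvalues of GEOMETRIC
  Frobenius, i.e. `charpoly ρ(Frob_v^{arith}) = ∏_j (X - ι⁻¹(α_j⁻¹))`, the accepted
  `arithFrobPolyOfSatake ι q_v 1 α`);
* Cogdell–Piatetski-Shapiro 1994, §2 (pp. 161–166): the datum `(L(Π ⊗ χ, s), L(Π̃ ⊗ χ⁻¹, s),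
  ε(Π ⊗ χ, s))_χ` of a factorizable admissible `Π` and the notion "nice" — the accepted carrier
  `TwistedStandardLData n K` and predicate `NiceTwistedStandardL` (`Automorphic/NiceTwistedStandardL`).

The object requested is "the `TwistedStandardLData n K` OF `ρ`": the carrier datum whose Satake
family is that of `ρ` and whose remaining fields are Taylor's local factors, `Γ`-shifts and
`ε`-data of the `ρ ⊗ χ`.

## What the tree can and cannot pin down (read before reviewing)

1. **Canonical and constructed: the Satake family.** The accepted
   `satakeFamilyOfFramedGaloisRep ι 1 ρ` (`GaloisRepresentations/SatakeFamilyOfFramedGaloisRep`) is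
   THE family `v ↦ {ι(r)⁻¹ : r an eigenvalue of ρ(Frob_v^{arith})}` (`n` non-zero entries, the
   unique multiset predicting the Frobenius characteristic polynomial wherever one does, in
   particular at every unramified place; Buzzard–Gee's L-normalisation `e = 1`). It is reused, not
   redefined.
2. **NOT constructible as a closed term — and why no `def ρ.twistedStandardLData` is offered.**
   The carrier's remaining fields are either genuine ARITHMETIC INPUT about `ρ` that is not a
   theorem for a general (even geometric) `ρ`, or local data the tree cannot yet compute:
   * `satake_norm_le` (`|a| ≤ q_v^c` off `S`, i.e. absolute convergence of `L(ιρ, s)` in a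
     half-plane, CPS p. 164) is, for `a = ι(r)⁻¹`, an archimedean bound on the `ι`-images of the
     Frobenius eigenvalues of `ρ` under an ARBITRARY field isomorphism `ι` — purity-type input
     (Taylor defines `L(ιR, s)` only for `R` pure; purity of a geometric `R` is §1 Conj. 3, open in
     general). For an abstract a.e.-unramified continuous `ρ` it is simply false in general.
   * `centralChar`, `prod_α` (`ω(ϖ_v) = ∏_i a_{i,v} = ι(det ρ(Frob_v^{geom}))`) ask for the Hecke
     character of the `ℓ`-adic character `ι ∘ det ρ`: it exists when `det ρ` is locally algebraic
     (Weil; Serre 1968, Ch. III §2.3), e.g. when `det ρ` is de Rham — in the tree this is the NAMED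
     FACT `FramedGaloisRep.exists_heckeCharacter_of_isDeRhamFramed` (Patrikis 2019, Prop. 2.2.1),
     unproved and existential, so no term can be extracted from it — and for a general continuous
     `ρ` it need not exist at all.
   * the inverse local factors at `v ∈ S` (`L(ι WD_v(ρ ⊗ χ), X)⁻¹`), the `Γ`-shifts (Taylor's
     `Γ(R, s)`, defined from labelled Hodge–Tate weights only under a parity hypothesis) and
     `(rootNumber, conductor)` (Deligne–Langlands local constants of the `WD_v(ρ ⊗ χ)`) have no
     pinned construction in the tree at this generality (the Weil–Deligne representation at `v ∤ ℓ`
     is a RELATION `IsWeilDeligneOfLadic`, Fontaine's `D_pst` a pinned-by-specification datum).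
   Moreover the requested signature quantified over `ReciprocityData K` / `IsGeometricFramed`, which
   are `Summit.Langlands` declarations (`Summits/Langlands/Langlands/Statement.lean`) and cannot
   occur in `Literature`. Only the a.e.-unramified clause of "geometric" is used below, as the
   field `isUnramifiedAt_of_not_mem`; the local Langlands data play no role in the unramified
   dictionary.
3. **What is delivered instead: the hypothesis-structure `CompletedGaloisTwistLData ι ρ`**, in
   the accepted pattern of `GenuineTwistedPi N K extends TwistedStandardLData N K`
   (`Automorphic/GenuineTwistedPi`): a carrier datum `D` TOGETHER WITH the two clauses tying it to
   `ρ` — off `D.S`, `ρ` is unramified and its Frobenii have characteristic polynomial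
   `arithFrobPolyOfSatake ι q_v 1 (D.α v)` (Buzzard–Gee Conj. 3.2.1, bullet 2, verbatim the
   per-place clause of the summit's `SatakeFrobCompatibleAt` without its automorphic conjunct). Its
   load-bearing fields are then CANONICAL as theorems: `D.α v = satakeFamilyOfFramedGaloisRep ι 1 ρ v`
   for every `v ∉ D.S` (`α_eq_satakeFamilyOfFramedGaloisRep`), hence two data of the same `ρ` have
   the same Satake parameters, the same unramified local factors of every twist
   (`twist_localFactor_eq`) off the union of their exceptional sets (`α_eq_of_not_mem`), and the
   requested almost-everywhere lemma holds (`eventually_isUnramifiedAt_and_hasFrobCharpolyAt`). The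
   fields the literature leaves to the local theory (`v ∈ S`, `∞`, `ε`) stay free exactly as in the
   carrier (junk confinement, module docstring of `NiceTwistedStandardL` §3), and the arithmetic
   input of item 2 is ASSERTED by inhabiting the structure: `Nonempty (CompletedGaloisTwistLData ι ρ)`
   implies that `ρ` is unramified almost everywhere (`eventually_isUnramifiedAt`) and that the
   `ι`-Frobenius eigenvalues satisfy the half-plane bound (`exists_satake_norm_le`). Planners state
   children over a shared datum as `∀ D : CompletedGaloisTwistLData ι ρ, …` (equivalently
   `∀ D : TwistedStandardLData n K, D.IsGaloisDatumOf ι ρ → …`, `forall_isGaloisDatumOf_iff`), and an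
   existential conclusion as `∃ D : CompletedGaloisTwistLData ι ρ, D.AllTwistsNice`.
4. Non-vacuity: the rank-`0` datum `CompletedGaloisTwistLData.glZero` over the accepted
   `TwistedStandardLData.glZero` (all its clauses are theorems: a `0 × 0` characteristic polynomial
   is `1 = arithFrobPolyOfSatake ι q 1 0`).

Everything in this file is a definition with a body or a proved lemma (no named facts).
`lean search 'CompletedGaloisTwistLData|IsGaloisDatumOf|twistedStandardLData'` (2026-08-17): no prior
declaration; `satakeFamilyOfFramedGaloisRep`, `TwistedStandardLData`, `NiceTwistedStandardL` reused.

## References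

* R. Taylor, *Galois representations*, Ann. Fac. Sci. Toulouse Math. (6) 13 (2004), 73–119
  (long version of the ICM 2002 lecture; arXiv:math/0212403): §1 Conj. 3, §2 (definition of
  `L(ιR, s)`, `Λ`, `N(R)`, `ε(ιR)`; Conj. 4). [TaylorGaloisRepresentations2004]
* K. Buzzard, T. Gee, *The conjectural connections between automorphic representations and Galois
  representations*, LMS LNS 414 (2014), §2.2, Conj. 3.2.1, Rem. 3.2.5. [BuzzardGeeLMS2014]
* J. W. Cogdell, I. I. Piatetski-Shapiro, *Converse theorems for `GL_n`*, Publ. Math. IHÉS 79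
  (1994), §2, pp. 161–166. [CogdellPiatetskishapiro1994]
* S. Patrikis, *Variations on a theorem of Tate*, Mem. AMS 258 (2019), Prop. 2.2.1. [Patrikis2019]
* J.-P. Serre, *Abelian ℓ-adic representations and elliptic curves* (1968), Ch. I §2.1–2.5,
  Ch. III. [SerreAbelianLadic1968]
-/

noncomputable section

open scoped MatrixGroups Matrix Polynomial NumberField
open NumberField IsDedekindDomain Field Polynomial Filter
open Literature.NumberTheory.Automorphic

namespace Literature.NumberTheory.GaloisRepresentations

/-! ### The carrier datum of `ρ` -/

section Carrier

variable {K : Type} [Field K] [NumberField K] {ℓ : ℕ} [Fact ℓ.Prime] {n : ℕ}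

/-- **The Cogdell–Piatetski-Shapiro `L`-datum of the `GL₁`-twists of the `ℓ`-adic Galois
representation `ρ : Γ_K → GL_n(ℚ̄_ℓ)` through `ι : ℚ̄_ℓ ≃ ℂ`** (Taylor 2004, §2: the datum
`(Λ(ι(ρ ⊗ χ), s), Λ(ι(ρ^∨ ⊗ χ⁻¹), s), ε(ι(ρ ⊗ χ), s))_χ`, Euler products over ALL places; here
over the accepted carrier `TwistedStandardLData n K` of Cogdell–Piatetski-Shapiro 1994, §2), as a
hypothesis-structure (module docstring §2–3): a carrier datum — exceptional set `S`, Satake family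
`α`, half-plane bound, central character, local factors of all twists and of their duals,
`Γ`-shifts, root numbers and conductors — together with the clauses tying it to `ρ` at the places
off `S` (Buzzard–Gee 2014, Conj. 3.2.1, bullet 2, with the dictionary of Rem. 3.2.5: geometric
Frobenius ↔ uniformiser, `e = 1`):
* `isUnramifiedAt_of_not_mem`: `ρ` is unramified off `S` (so `S` contains the ramification of
  `ρ`, and a datum exists only for `ρ` unramified almost everywhere);
* `hasFrobCharpolyAt_of_not_mem`: off `S`, every arithmetic Frobenius at `v` has characteristic
  polynomial `∏_{a ∈ α v} (X - ι⁻¹(a⁻¹))` on `ρ` (accepted `arithFrobPolyOfSatake ι q_v 1 (α v)`),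
  i.e. `α v` is the multiset of `ι`-images of the eigenvalues of geometric Frobenius.
Consequently `α = satakeFamilyOfFramedGaloisRep ι 1 ρ` off `S` (`α_eq_satakeFamilyOfFramedGaloisRep`):
the Satake family, hence the unramified local factors of every twist, are determined by `ρ`; the
data at `v ∈ S`, at `∞` and of `ε` are free as in the carrier; and INHABITING the structure asserts
the half-plane bound on the `ι`-Frobenius eigenvalues (`exists_satake_norm_le`) and the existence
of the Hecke character `centralChar` with `centralChar(ϖ_v) = ι(det ρ(Frob_v^{geom}))` off `S` —
arithmetic input which is not a theorem for a general `ρ` (module docstring §2), which is why no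
closed term of this type is constructed for a general `ρ`.
[cite: TaylorGaloisRepresentations2004, §2 (definition of L(ιR, s), Λ(ιR, s), N(R), ε(ιR))]
[cite: BuzzardGeeLMS2014, Conj. 3.2.1 and Rem. 3.2.5]
[cite: CogdellPiatetskishapiro1994, §2 Definition (p. 165)] -/
structure CompletedGaloisTwistLData (ι : PadicAlgCl ℓ ≃+* ℂ) (ρ : FramedGaloisRep K (PadicAlgCl ℓ) n)
    extends TwistedStandardLData n K where
  /-- Off `S`, `ρ` is unramified. -/
  isUnramifiedAt_of_not_mem : ∀ v ∉ S, ρ.IsUnramifiedAt v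
  /-- Off `S`, every arithmetic Frobenius at `v` has characteristic polynomial
  `∏_{a ∈ α v} (X - ι⁻¹(a⁻¹))` on `ρ`: `α v` is the Satake parameter predicted by `ρ` at `v`. -/
  hasFrobCharpolyAt_of_not_mem : ∀ v ∉ S,
    ρ.HasFrobCharpolyAt v (arithFrobPolyOfSatake ι v.residueCard 1 (α v))

namespace CompletedGaloisTwistLData

section Canonical

variable {ι : PadicAlgCl ℓ ≃+* ℂ} {ρ : FramedGaloisRep K (PadicAlgCl ℓ) n}
  (D : CompletedGaloisTwistLData ι ρ)

/-- **The Satake family of a datum of `ρ` is the Satake family of `ρ`**: off `S`,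
`D.α v = satakeFamilyOfFramedGaloisRep ι 1 ρ v` (uniqueness of the multiset predicting the Frobenius
characteristic polynomial, accepted `satakeFamilyOfFramedGaloisRep_eq_of_hasFrobCharpolyAt`).
Buzzard–Gee 2014, Rem. 3.2.5. [folklore] -/
theorem α_eq_satakeFamilyOfFramedGaloisRep {v : HeightOneSpectrum (𝓞 K)} (hv : v ∉ D.S) :
    D.α v = satakeFamilyOfFramedGaloisRep ι 1 ρ v :=
  (satakeFamilyOfFramedGaloisRep_eq_of_hasFrobCharpolyAt (D.hasFrobCharpolyAt_of_not_mem v hv)).symm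

/-- **Two data of the same `ρ` have the same Satake parameters** off the union of their
exceptional sets. [folklore] -/
theorem α_eq_of_not_mem (D' : CompletedGaloisTwistLData ι ρ) {v : HeightOneSpectrum (𝓞 K)}
    (hv : v ∉ D.S) (hv' : v ∉ D'.S) : D.α v = D'.α v := by
  rw [D.α_eq_satakeFamilyOfFramedGaloisRep hv, D'.α_eq_satakeFamilyOfFramedGaloisRep hv']

/-- The Satake families of two data of the same `ρ` agree at all but finitely many places.
[folklore] -/
theorem α_eventuallyEq (D' : CompletedGaloisTwistLData ι ρ) : D.α =ᶠ[cofinite] D'.α :=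
  (D.S.eventually_cofinite_notMem.and D'.S.eventually_cofinite_notMem).mono
    fun _ h ↦ D.α_eq_of_not_mem D' h.1 h.2

/-- A datum of `ρ` exists only for `ρ` **unramified almost everywhere** (the exceptional set is
finite). [folklore] -/
theorem eventually_isUnramifiedAt (D : CompletedGaloisTwistLData ι ρ) :
    ∀ᶠ v : HeightOneSpectrum (𝓞 K) in cofinite, ρ.IsUnramifiedAt v :=
  D.S.eventually_cofinite_notMem.mono fun v hv ↦ D.isUnramifiedAt_of_not_mem v hv

/-- **The requested almost-everywhere clause**: at all but finitely many finite places `ρ` is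
unramified and its Frobenii have characteristic polynomial `arithFrobPolyOfSatake ι q_v 1 (D.α v)`
(the Satake–Frobenius clause of Buzzard–Gee Conj. 3.2.1 with `α = D.α v`).
[cite: BuzzardGeeLMS2014, Conj. 3.2.1] -/
theorem eventually_isUnramifiedAt_and_hasFrobCharpolyAt :
    ∀ᶠ v : HeightOneSpectrum (𝓞 K) in cofinite, ρ.IsUnramifiedAt v ∧
      ρ.HasFrobCharpolyAt v (arithFrobPolyOfSatake ι v.residueCard 1 (D.α v)) :=
  D.S.eventually_cofinite_notMem.mono
    fun v hv ↦ ⟨D.isUnramifiedAt_of_not_mem v hv, D.hasFrobCharpolyAt_of_not_mem v hv⟩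

/-- The same clause over the CANONICAL family: at all but finitely many places `ρ` is unramified,
its Frobenii have characteristic polynomial `arithFrobPolyOfSatake ι q_v 1 (satakeFamily… ι 1 ρ v)`,
and `D.α v` is that family. [folklore] -/
theorem eventually_hasFrobCharpolyAt_satakeFamilyOfFramedGaloisRep :
    ∀ᶠ v : HeightOneSpectrum (𝓞 K) in cofinite, ρ.IsUnramifiedAt v ∧
      ρ.HasFrobCharpolyAt v
        (arithFrobPolyOfSatake ι v.residueCard 1 (satakeFamilyOfFramedGaloisRep ι 1 ρ v)) ∧
      D.α v = satakeFamilyOfFramedGaloisRep ι 1 ρ v :=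
  D.S.eventually_cofinite_notMem.mono fun v hv ↦
    ⟨D.isUnramifiedAt_of_not_mem v hv,
      (D.isUnramifiedAt_of_not_mem v hv).hasFrobCharpolyAt_satakeFamilyOfFramedGaloisRep ι 1,
      D.α_eq_satakeFamilyOfFramedGaloisRep hv⟩

/-- **Satake parameters of a datum of `ρ` are non-zero** off `S` (they are the `ι(r)⁻¹` over the
eigenvalues `r` of an invertible matrix; also a consequence of the carrier's `prod_α`).
[folklore] -/
theorem α_ne_zero {v : HeightOneSpectrum (𝓞 K)} (hv : v ∉ D.S) : ∀ a ∈ D.α v, a ≠ 0 := by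
  rw [D.α_eq_satakeFamilyOfFramedGaloisRep hv]
  exact satakeFamilyOfFramedGaloisRep_ne_zero ι 1 ρ v

/-- **Inhabiting the structure asserts the half-plane bound on the `ι`-Frobenius eigenvalues of
`ρ`**: there is `c` with `|a| ≤ q_v^c` for every entry `a = ι(r)⁻¹` of the canonical Satake family
at all but finitely many `v` (the carrier's standing hypothesis `satake_norm_le`, CPS 1994 p. 164,
transported along `α_eq_satakeFamilyOfFramedGaloisRep`) — purity-type input about `ρ`, not a
theorem for a general `ρ` (Taylor 2004, §1 Conj. 3).
[cite: CogdellPiatetskishapiro1994, §2 Lemma 2.2 (p. 164)] -/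
theorem exists_satake_norm_le (D : CompletedGaloisTwistLData ι ρ) :
    ∃ c : ℝ, ∀ᶠ v : HeightOneSpectrum (𝓞 K) in cofinite,
      ∀ a ∈ satakeFamilyOfFramedGaloisRep ι 1 ρ v, ‖a‖ ≤ (v.residueCard : ℝ) ^ c := by
  obtain ⟨c, hc⟩ := D.satake_norm_le
  exact ⟨c, D.S.eventually_cofinite_notMem.mono fun v hv a ha ↦
    hc v hv a (by rwa [D.α_eq_satakeFamilyOfFramedGaloisRep hv])⟩

/-- **Off `S` the local factors of the twists are determined by `ρ` and `χ`**: for `χ` unramified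
at `v ∉ S`, `P_{v,χ} = ∏_{a} (1 - χ(ϖ_v) a X)` over the canonical Satake family of `ρ` at `v`, and
`P_{v,χ} = 1` for `χ` ramified at `v` (carrier `twist_localFactor_eq_ite` with
`α_eq_satakeFamilyOfFramedGaloisRep`; this is `L(ι WD_v(ρ ⊗ χ), X)⁻¹` at an unramified `v`, Taylor
2004, §2). [cite: TaylorGaloisRepresentations2004, §2] -/
theorem twist_localFactor_eq (χ : HeckeCharacter K) {v : HeightOneSpectrum (𝓞 K)} (hv : v ∉ D.S)
    [Decidable (χ.IsUnramifiedAt v)] :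
    D.twist.localFactor χ v = if χ.IsUnramifiedAt v then
      eulerPolynomial ((satakeFamilyOfFramedGaloisRep ι 1 ρ v).map
        fun a => χ.valueAtUniformizer v * a) else 1 := by
  rw [D.twist_localFactor_eq_ite χ hv, D.α_eq_satakeFamilyOfFramedGaloisRep hv]

/-- Off `S` the local factors of the twists of the dual are determined by `ρ` and `χ`:
`∏_{a} (1 - χ(ϖ_v) a⁻¹ X)` over the canonical Satake family for `χ` unramified at `v`, `1` otherwise.
[cite: TaylorGaloisRepresentations2004, §2] -/
theorem dualTwist_localFactor_eq (χ : HeckeCharacter K) {v : HeightOneSpectrum (𝓞 K)}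
    (hv : v ∉ D.S) [Decidable (χ.IsUnramifiedAt v)] :
    D.dualTwist.localFactor χ v = if χ.IsUnramifiedAt v then
      eulerPolynomial ((satakeFamilyOfFramedGaloisRep ι 1 ρ v).map
        fun a => χ.valueAtUniformizer v * a⁻¹) else 1 := by
  rw [D.dualTwist_localFactor_eq_ite χ hv, D.α_eq_satakeFamilyOfFramedGaloisRep hv]

/-- **Two data of the same `ρ` have the same unramified local factors of every twist** off the
union of their exceptional sets. [folklore] -/
theorem twist_localFactor_eq_of_not_mem (D' : CompletedGaloisTwistLData ι ρ) (χ : HeckeCharacter K)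
    {v : HeightOneSpectrum (𝓞 K)} (hv : v ∉ D.S) (hv' : v ∉ D'.S) :
    D.twist.localFactor χ v = D'.twist.localFactor χ v := by
  classical
  rw [D.twist_localFactor_eq χ hv, D'.twist_localFactor_eq χ hv']

/-- The central character of a datum of `ρ` takes the value `∏_{a ∈ α_v} a` — the `ι`-image of the
determinant of GEOMETRIC Frobenius — at the uniformiser of every `v ∉ S` (carrier `prod_α` with
`α_eq_satakeFamilyOfFramedGaloisRep`). [folklore] -/
theorem centralChar_valueAtUniformizer_eq {v : HeightOneSpectrum (𝓞 K)} (hv : v ∉ D.S) :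
    D.centralChar.valueAtUniformizer v = (satakeFamilyOfFramedGaloisRep ι 1 ρ v).prod := by
  rw [← D.prod_α v hv, D.α_eq_satakeFamilyOfFramedGaloisRep hv]

end Canonical

section Nice

variable {ι : PadicAlgCl ℓ ≃+* ℂ} {ρ : FramedGaloisRep K (PadicAlgCl ℓ) n}

/-- **`Λ(s, ρ ⊗ ω)` is nice** for the datum `D` of `ρ`: the accepted PREDICATE
`NiceTwistedStandardL` on the carrier datum (dot-notation alias; it holds for some `(D, ω)` and
fails for others — Taylor 2004, §2 Conj. 4 predicts it for irreducible pure de Rham `ρ` not a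
Tate twist of the trivial character). [cite: CogdellPiatetskishapiro1994, §2 Definition (p. 165)] -/
abbrev IsNice (D : CompletedGaloisTwistLData ι ρ) (ω : HeckeCharacter K) : Prop :=
  NiceTwistedStandardL D.toTwistedStandardLData ω

/-- **All `GL₁`-twists `Λ(s, ρ ⊗ ω)` are nice** (the accepted `TwistedStandardLData.AllTwistsNice`
of the carrier datum): a PREDICATE on the datum `D` of `ρ`.
[cite: CogdellPiatetskishapiro1994, §2 (p. 166)] -/
abbrev AllTwistsNice (D : CompletedGaloisTwistLData ι ρ) : Prop :=
  D.toTwistedStandardLData.AllTwistsNice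

/-- Unfolding `AllTwistsNice`. [folklore] -/
theorem allTwistsNice_iff (D : CompletedGaloisTwistLData ι ρ) :
    D.AllTwistsNice ↔ ∀ ω : HeckeCharacter K, D.IsNice ω := Iff.rfl

end Nice

end CompletedGaloisTwistLData

/-! ### The predicate form on carrier data -/

/-- A carrier datum `D` **is a datum of `ρ` (through `ι`)** if it underlies some
`CompletedGaloisTwistLData ι ρ`, i.e. iff `ρ` is unramified off `D.S` with Frobenius characteristic
polynomials `arithFrobPolyOfSatake ι q_v 1 (D.α v)` there (`isGaloisDatumOf_iff`; the extension adds no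
data). Buzzard–Gee 2014, Conj. 3.2.1. [cite: BuzzardGeeLMS2014, Conj. 3.2.1] -/
abbrev _root_.Literature.NumberTheory.Automorphic.TwistedStandardLData.IsGaloisDatumOf
    (ι : PadicAlgCl ℓ ≃+* ℂ) (ρ : FramedGaloisRep K (PadicAlgCl ℓ) n) (D : TwistedStandardLData n K) :
    Prop :=
  ∃ G : CompletedGaloisTwistLData ι ρ, G.toTwistedStandardLData = D

variable (ι : PadicAlgCl ℓ ≃+* ℂ) (ρ : FramedGaloisRep K (PadicAlgCl ℓ) n)

/-- The carrier datum of a `CompletedGaloisTwistLData ι ρ` is a datum of `ρ`. [folklore] -/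
theorem CompletedGaloisTwistLData.isGaloisDatumOf (G : CompletedGaloisTwistLData ι ρ) :
    G.toTwistedStandardLData.IsGaloisDatumOf ι ρ :=
  ⟨G, rfl⟩

/-- `D.IsGaloisDatumOf ι ρ` unfolded: `ρ` is unramified off `D.S` and its Frobenii have characteristic
polynomial `arithFrobPolyOfSatake ι q_v 1 (D.α v)` there (declared in the carrier's namespace, for
dot notation on `D`). [folklore] -/
theorem _root_.Literature.NumberTheory.Automorphic.TwistedStandardLData.isGaloisDatumOf_iff
    (D : TwistedStandardLData n K) :
    D.IsGaloisDatumOf ι ρ ↔ (∀ v ∉ D.S, ρ.IsUnramifiedAt v) ∧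
      ∀ v ∉ D.S, ρ.HasFrobCharpolyAt v (arithFrobPolyOfSatake ι v.residueCard 1 (D.α v)) := by
  constructor
  · rintro ⟨G, rfl⟩
    exact ⟨G.isUnramifiedAt_of_not_mem, G.hasFrobCharpolyAt_of_not_mem⟩
  · rintro ⟨h₁, h₂⟩
    exact ⟨⟨D, h₁, h₂⟩, rfl⟩

/-- A statement about all data of `ρ` in predicate form is a statement about all
`CompletedGaloisTwistLData ι ρ`. [folklore] -/
theorem _root_.Literature.NumberTheory.Automorphic.TwistedStandardLData.forall_isGaloisDatumOf_iff
    (Q : TwistedStandardLData n K → Prop) :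
    (∀ D : TwistedStandardLData n K, D.IsGaloisDatumOf ι ρ → Q D) ↔
      ∀ G : CompletedGaloisTwistLData ι ρ, Q G.toTwistedStandardLData :=
  ⟨fun h G => h _ (G.isGaloisDatumOf ι ρ), fun h _ ⟨G, hG⟩ => hG ▸ h G⟩

/-- An existential statement about a datum of `ρ` in predicate form is one about some
`CompletedGaloisTwistLData ι ρ`. [folklore] -/
theorem _root_.Literature.NumberTheory.Automorphic.TwistedStandardLData.exists_isGaloisDatumOf_iff
    (Q : TwistedStandardLData n K → Prop) :
    (∃ D : TwistedStandardLData n K, D.IsGaloisDatumOf ι ρ ∧ Q D) ↔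
      ∃ G : CompletedGaloisTwistLData ι ρ, Q G.toTwistedStandardLData :=
  ⟨fun ⟨_, ⟨G, hG⟩, hQ⟩ => ⟨G, hG ▸ hQ⟩, fun ⟨G, hQ⟩ => ⟨_, G.isGaloisDatumOf ι ρ, hQ⟩⟩

/-- A datum of `ρ` through the predicate has the canonical Satake family off its exceptional set.
[folklore] -/
theorem _root_.Literature.NumberTheory.Automorphic.TwistedStandardLData.IsGaloisDatumOf.α_eq
    {D : TwistedStandardLData n K}
    (h : D.IsGaloisDatumOf ι ρ) {v : HeightOneSpectrum (𝓞 K)} (hv : v ∉ D.S) :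
    D.α v = satakeFamilyOfFramedGaloisRep ι 1 ρ v := by
  obtain ⟨G, rfl⟩ := h
  exact G.α_eq_satakeFamilyOfFramedGaloisRep hv

end Carrier

/-! ### Non-vacuity: rank zero -/

section GLZero

variable (K : Type) [Field K] [NumberField K] {ℓ : ℕ} [Fact ℓ.Prime]

/-- A `0 × 0` matrix has characteristic polynomial `1`. [folklore] -/
theorem FramedRep.charpoly_eq_one_of_rank_zero {G : Type*} [Group G] [TopologicalSpace G]
    {A : Type*} [CommRing A] [Nontrivial A] [TopologicalSpace A] (ρ : FramedRep G A 0) (g : G) :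
    FramedRep.charpoly ρ g = 1 :=
  Polynomial.eq_one_of_monic_natDegree_zero (Matrix.charpoly_monic _)
    (by rw [FramedRep.charpoly, Matrix.charpoly_natDegree_eq_dim, Fintype.card_fin])

/-- **Non-vacuity**: the datum of the (unique, trivial) rank-`0` representation over the accepted
`GL₀` carrier datum `TwistedStandardLData.glZero K` (all `L`-functions and `ε` equal to `1`): every
tying clause is a theorem — `ρ` is unramified everywhere (`GL₀` is trivial) and every Frobenius has
characteristic polynomial `1 = arithFrobPolyOfSatake ι q 1 0`. [folklore] -/
def CompletedGaloisTwistLData.glZero (ι : PadicAlgCl ℓ ≃+* ℂ)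
    (ρ : FramedGaloisRep K (PadicAlgCl ℓ) 0) : CompletedGaloisTwistLData ι ρ where
  toTwistedStandardLData := TwistedStandardLData.glZero K
  isUnramifiedAt_of_not_mem _ _ _ _ σ _ := Subsingleton.elim _ _
  hasFrobCharpolyAt_of_not_mem v _ _ _ σ _ := by
    rw [FramedRep.charpoly_eq_one_of_rank_zero]
    simp [TwistedStandardLData.glZero, arithFrobPolyOfSatake]

/-- Every twist of the rank-`0` datum is nice (accepted `niceTwistedStandardL_glZero`). [folklore] -/
theorem CompletedGaloisTwistLData.allTwistsNice_glZero (ι : PadicAlgCl ℓ ≃+* ℂ)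
    (ρ : FramedGaloisRep K (PadicAlgCl ℓ) 0) : (CompletedGaloisTwistLData.glZero K ι ρ).AllTwistsNice :=
  niceTwistedStandardL_glZero K

end GLZero

end Literature.NumberTheory.GaloisRepresentations

end
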